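import Summits.CriticalPhenomena.Ising3D.ExclusionSentencesPiFormsLin
import Summits.CriticalPhenomena.Ising3D.ExclusionSentencesCatalan

/-!
# Exclusion sentences — family `LIN` with all seven constants in kernel form
(cell `pub-ising3x`, seat recog-1)

HONEST FRAMING: lottery ticket; floor = tightest certified 3D Ising CFT bounds; no exact-solution
claim without a proof.

`ExclusionSentencesPiFormsLin.lean` gave the kernel sentence for the `π, π², π³, log 2` part (`LINπ`) of the
FAMILIES-v1 family `LIN` (`HOME/frozen/FAMILIES-v1.json`, SCOPE.md §3.1: `x = (a₀ + Σ_{i∈S} aᵢKᵢ)/aₓ`,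
`|S| ≤ 2` exhaustive table, `|aᵢ|, aₓ ≤ H = 12`, `a₀ ∈ ℤ` free).  With the certified enclosures of `ζ(3)`,
`ζ(5)` (`ExclusionSentencesZetaValues.lean`) and `G` (`ExclusionSentencesCatalan.lean`) this file covers
the WHOLE table, `K = (π, π², π³, log 2, ζ(3), ζ(5), G)`:
* `lin7Val 0 [c₁, …, c₇] = Σ cᵢKᵢ` (`lin7Val_seven`), enclosure `lin7Encl` (`lin7Val_mem`), `linFamily H`;
* checker `linExcluded H a b ex`: ONE pass over the coefficient vectors (`loopNZ` of the `LINπ` file) in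
  SCALED-INTEGER arithmetic (scale `10¹⁸`: `kZ`, `linZEncl`, `linZLeaf`; integer floor / ceiling division
  for the `a₀` candidates) — the rational-interval leaf of `LINπ` costs ≈ 15 ms of kernel time per vector
  and the full table has 12 265 vectors, more than one kernel evaluation sustains (measured); the integer
  leaf costs ≈ 5 ms.  Even so ONE kernel evaluation of the whole table does not go through (`H = 8`, 5 488
  vectors, does): at `H = 12` state the four parts `linExcludedPart H p a b ex = true` as separate one-line
  theorems and assemble with `linExcluded_of_parts`.  Candidates inside the outward-rounded range must be LISTED;
* **`linExcluded_sound`**: every member of `linFamily H` in `[a, b]` EQUALS the value `lin7TupleVal e` of a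
  listed tuple `e = (a₀, [c₁, …, c₇], aₓ)` (up to proportionality);
* bridges `sigma_lin_covered_of_isingEnclosure`, `eps_lin_covered_of_isingEnclosure`.
The enclosure of a member has width `≤ 2·12·10⁻¹⁰` (dominated by `log 2`); narrower undecidable cases must be
listed.  Python twin (same enclosures and loops): `HOME/pub-ising3x-recog-1/lean/tools/trglin_exceptions.py`.
No 3D digit is used; instances (and the refinement lemma `not_mem_linFamily_of_refine` for narrower
intervals) live in `ExclusionSentencesControl2DZeta.lean`.
-/

namespace Summit.CriticalPhenomena.Ising3D

open Literature.MathematicalPhysics.QuantumFieldTheory.ConformalBootstrap3D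

/-! ### `LIN` with the seven constants `K = (π, π², π³, log 2, ζ(3), ζ(5), G)` -/

/-- Enclosure of `K_i` (`i = 0..6`: `π, π², π³, log 2, ζ(3), ζ(5), G`; `i ≥ 6` means `G`). -/
def k7I : ℕ → ℚ × ℚ
  | 0 => piI
  | 1 => powI piI 2
  | 2 => powI piI 3
  | 3 => log2I
  | 4 => zeta3I
  | 5 => zeta5I
  | _ => catalanI

/-- The constant `K_i` (`i = 0..6`: `π, π², π³, log 2, ζ(3), ζ(5), G`; `i ≥ 6` means `G`). -/
noncomputable def k7Val : ℕ → ℝ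
  | 0 => Real.pi
  | 1 => Real.pi ^ 2
  | 2 => Real.pi ^ 3
  | 3 => Real.log 2
  | 4 => zeta3
  | 5 => zeta5
  | _ => catalan

/-- Soundness of `k7I`. -/
theorem k7Val_mem (i : ℕ) : k7Val i ∈ InI (k7I i) := by
  have hpi : (0 : ℚ) ≤ piI.1 := by norm_num [piI]
  match i with
  | 0 => exact pi_mem_piI
  | 1 => exact powI_sound hpi pi_mem_piI 2
  | 2 => exact powI_sound hpi pi_mem_piI 3
  | 3 => exact log2_mem_log2I
  | 4 => exact zeta3_mem_zeta3I
  | 5 => exact zeta5_mem_zeta5I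
  | n + 6 => exact catalan_mem_catalanI

/-- `lin7Val i [cᵢ, cᵢ₊₁, …] = Σ_j c_j K_j` over the seven-constant list. -/
noncomputable def lin7Val : ℕ → List ℤ → ℝ
  | _, [] => 0
  | i, c :: cs => (c : ℝ) * k7Val i + lin7Val (i + 1) cs

/-- The printed form: `lin7Val 0 [c₁, …, c₇] = c₁π + c₂π² + c₃π³ + c₄ log 2 + c₅ζ(3) + c₆ζ(5) + c₇G`. -/
theorem lin7Val_seven (c₁ c₂ c₃ c₄ c₅ c₆ c₇ : ℤ) :
    lin7Val 0 [c₁, c₂, c₃, c₄, c₅, c₆, c₇] = c₁ * Real.pi + c₂ * Real.pi ^ 2 + c₃ * Real.pi ^ 3 +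
      c₄ * Real.log 2 + c₅ * zeta3 + c₆ * zeta5 + c₇ * catalan := by
  simp only [lin7Val, k7Val]; ring

/-- Rational enclosure of `lin7Val i c`. -/
def lin7Encl : ℕ → List ℤ → ℚ × ℚ
  | _, [] => (0, 0)
  | i, c :: cs => addI (smulI c (k7I i)) (lin7Encl (i + 1) cs)

/-- Soundness of `lin7Encl`. -/
theorem lin7Val_mem : ∀ (i : ℕ) (c : List ℤ), lin7Val i c ∈ InI (lin7Encl i c)
  | _, [] => by simp [lin7Val, lin7Encl, InI]
  | i, c :: cs => by
      simp only [lin7Val, lin7Encl]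
      exact addI_sound (smulI_sound c (k7Val_mem i)) (lin7Val_mem (i + 1) cs)

/-- Proportional coefficient lists give proportional values. -/
theorem lin7Val_mul_eq {t t' : ℤ} : ∀ (i : ℕ) (c c' : List ℤ),
    c.map (· * t) = c'.map (· * t') → lin7Val i c * t = lin7Val i c' * t'
  | _, [], c', h => by
      have : c' = [] := by simpa using h.symm
      subst this; simp [lin7Val]
  | i, v :: cs, c', h => by
      match c', h with
      | v' :: cs', h =>
        simp only [List.map_cons, List.cons.injEq] at h
        obtain ⟨hv, hcs⟩ := h
        have ih := lin7Val_mul_eq (i + 1) cs cs' hcs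
        have hv' : (v : ℝ) * t = v' * t' := by exact_mod_cast hv
        simp only [lin7Val]
        calc ((v : ℝ) * k7Val i + lin7Val (i + 1) cs) * t
            = (v : ℝ) * t * k7Val i + lin7Val (i + 1) cs * t := by ring
          _ = (v' : ℝ) * t' * k7Val i + lin7Val (i + 1) cs' * t' := by rw [hv', ih]
          _ = ((v' : ℝ) * k7Val i + lin7Val (i + 1) cs') * t' := by ring

/-- `linFamily H`: `x = (a₀ + c₁π + c₂π² + c₃π³ + c₄ log 2 + c₅ζ(3) + c₆ζ(5) + c₇G)/aₓ` with
`c = [c₁, …, c₇] ≠ 0`, at most two `cᵢ ≠ 0`, `|cᵢ| ≤ H`, `1 ≤ aₓ ≤ H`, `a₀ ∈ ℤ` (FAMILIES-v1 LIN,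
`|S| ≤ 2` part = the exhaustive table, `H = 12`; tuples need not be primitive — a superset). -/
def linFamily (H : ℕ) : Set ℝ :=
  {x | ∃ (a₀ : ℤ) (c : List ℤ) (ax : ℕ), c.length = 7 ∧ 1 ≤ ax ∧ ax ≤ H ∧
    (∀ y ∈ c, -(H : ℤ) ≤ y ∧ y ≤ H) ∧ (c.filter (· ≠ 0)).length ≤ 2 ∧ c ≠ [0, 0, 0, 0, 0, 0, 0] ∧
    x = ((a₀ : ℝ) + lin7Val 0 c) / ax}

/-- A listed LIN tuple `(a₀, [c₁, …, c₇], aₓ)` and its value. -/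
noncomputable def lin7TupleVal (e : ℤ × List ℤ × ℕ) : ℝ := ((e.1 : ℝ) + lin7Val 0 e.2.1) / e.2.2

/-! ### The checker: scaled-integer arithmetic (scale `10¹⁸`), one pass over all coefficient vectors -/

/-- Scale of the integer arithmetic of the LIN checker. -/
def linS : ℕ := 10 ^ 18

/-- Integer enclosures `(lo, hi)` of `10¹⁸·K_i`, rounded outward from `k7I`. -/
def kZ : ℕ → ℤ × ℤ
  | 0 => (3141592653589793238, 3141592653589793239)
  | 1 => (9869604401089358618, 9869604401089358619)
  | 2 => (31006276680299820175, 31006276680299820176)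
  | 3 => (693147180457734309, 693147180657734310)
  | 4 => (1202056903159509000, 1202056903159597000)
  | 5 => (1036927755143367000, 1036927755143491000)
  | _ => (915965594177202000, 915965594177234000)

/-- From a rational enclosure of `K` and two decided comparisons: an integer enclosure of `S·K`. -/
theorem scaled_mem_of_encl {K : ℝ} {I : ℚ × ℚ} {z : ℤ × ℤ} (hK : K ∈ InI I)
    (h1 : (z.1 : ℚ) ≤ linS * I.1) (h2 : (linS : ℚ) * I.2 ≤ z.2) :
    (z.1 : ℝ) ≤ linS * K ∧ (linS : ℝ) * K ≤ z.2 := by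
  obtain ⟨hK1, hK2⟩ := hK
  have h1' : ((z.1 : ℚ) : ℝ) ≤ ((linS * I.1 : ℚ) : ℝ) := Rat.cast_le.mpr h1
  have h2' : ((linS * I.2 : ℚ) : ℝ) ≤ ((z.2 : ℚ) : ℝ) := Rat.cast_le.mpr h2
  push_cast at h1' h2'
  have hS : (0 : ℝ) ≤ (linS : ℝ) := by positivity
  exact ⟨h1'.trans (mul_le_mul_of_nonneg_left hK1 hS), (mul_le_mul_of_nonneg_left hK2 hS).trans h2'⟩

/-- Soundness of `kZ`: `(kZ i).1 ≤ 10¹⁸·K_i ≤ (kZ i).2`. -/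
theorem kZ_sound (i : ℕ) : ((kZ i).1 : ℝ) ≤ linS * k7Val i ∧ (linS : ℝ) * k7Val i ≤ (kZ i).2 := by
  match i with
  | 0 => exact scaled_mem_of_encl (k7Val_mem 0) (by decide +kernel) (by decide +kernel)
  | 1 => exact scaled_mem_of_encl (k7Val_mem 1) (by decide +kernel) (by decide +kernel)
  | 2 => exact scaled_mem_of_encl (k7Val_mem 2) (by decide +kernel) (by decide +kernel)
  | 3 => exact scaled_mem_of_encl (k7Val_mem 3) (by decide +kernel) (by decide +kernel)
  | 4 => exact scaled_mem_of_encl (k7Val_mem 4) (by decide +kernel) (by decide +kernel)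
  | 5 => exact scaled_mem_of_encl (k7Val_mem 5) (by decide +kernel) (by decide +kernel)
  | 6 => exact scaled_mem_of_encl (k7Val_mem 6) (by decide +kernel) (by decide +kernel)
  | n + 7 =>
      exact scaled_mem_of_encl (I := catalanI) (z := kZ 7) (k7Val_mem (n + 7)) (by decide +kernel)
        (by decide +kernel)

/-- Integer enclosure of `10¹⁸·Σ_j c_j K_j` (zero coefficients skipped). -/
def linZEncl : ℕ → List ℤ → ℤ × ℤ
  | _, [] => (0, 0)
  | i, c :: cs =>
      if c = 0 then linZEncl (i + 1) cs
      else if 0 < c then (c * (kZ i).1 + (linZEncl (i + 1) cs).1, c * (kZ i).2 + (linZEncl (i + 1) cs).2)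
      else (c * (kZ i).2 + (linZEncl (i + 1) cs).1, c * (kZ i).1 + (linZEncl (i + 1) cs).2)

/-- Soundness of `linZEncl`. -/
theorem linZEncl_sound : ∀ (i : ℕ) (c : List ℤ),
    ((linZEncl i c).1 : ℝ) ≤ linS * lin7Val i c ∧ (linS : ℝ) * lin7Val i c ≤ (linZEncl i c).2
  | _, [] => by simp [linZEncl, lin7Val]
  | i, c :: cs => by
      obtain ⟨ih1, ih2⟩ := linZEncl_sound (i + 1) cs
      obtain ⟨hk1, hk2⟩ := kZ_sound i
      simp only [linZEncl, lin7Val]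
      split_ifs with h0 hpos
      · subst h0; simp only [Int.cast_zero, zero_mul, zero_add]; exact ⟨ih1, ih2⟩
      · have hc : (0 : ℝ) ≤ c := by exact_mod_cast hpos.le
        push_cast
        constructor
        · nlinarith [mul_le_mul_of_nonneg_left hk1 hc]
        · nlinarith [mul_le_mul_of_nonneg_left hk2 hc]
      · have hc : (c : ℝ) ≤ 0 := by exact_mod_cast (not_lt.mp hpos)
        push_cast
        constructor
        · nlinarith [mul_le_mul_of_nonpos_left hk2 hc]
        · nlinarith [mul_le_mul_of_nonpos_left hk1 hc]

/-- `⌊10¹⁸ a⌋` — the scaled lower end (rounded outward). -/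
def linAlo (a : ℚ) : ℤ := ⌊(linS : ℚ) * a⌋

/-- `⌈10¹⁸ b⌉` — the scaled upper end (rounded outward). -/
def linBhi (b : ℚ) : ℤ := ⌈(linS : ℚ) * b⌉

/-- A candidate `(a₀, c, aₓ)` passes only if it is proportional to a listed tuple with positive denominator
(inside the outward-rounded range nothing is excludable at the enclosures' precision). -/
def linZCandOK (ex : List (ℤ × List ℤ × ℕ)) (c : List ℤ) (ax : ℕ) (a₀ : ℤ) : Bool :=
  ex.any fun e => decide (0 < e.2.2 ∧ a₀ * (e.2.2 : ℤ) = e.1 * ax ∧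
    c.map (· * (e.2.2 : ℤ)) = e.2.1.map (· * (ax : ℤ)))

/-- Leaf for a coefficient vector `c` with integer enclosure `T` of `10¹⁸·Σ cᵢKᵢ`: for each `aₓ ∈ [1, H]`, the
integers `a₀` with `Alo·aₓ − T.hi ≤ 10¹⁸ a₀ ≤ Bhi·aₓ − T.lo` (integer ceiling / floor division). -/
def linZLeaf (H : ℕ) (Alo Bhi : ℤ) (ex : List (ℤ × List ℤ × ℕ)) (T : ℤ × ℤ) (c : List ℤ) : Bool :=
  (List.range' 1 H).all fun ax =>
    allIntIcc (-((-(Alo * ax - T.2)) / (linS : ℤ))) ((Bhi * ax - T.1) / (linS : ℤ)) (linZCandOK ex c ax)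

/-- The coefficient vectors whose FIRST non-zero entry sits at index `i` (value `v ∈ [−H, H] ∖ {0}`), with at
most one further non-zero entry after it (`loopNZ` of the `LINπ` file, budget 1), through the integer leaf. -/
def linExcludedFirst (H i : ℕ) (a b : ℚ) (ex : List (ℤ × List ℤ × ℕ)) : Bool :=
  allIntIcc (-(H : ℤ)) H fun v => decide (v = 0) ||
    loopNZ H (6 - i) 1 (List.replicate i 0 ++ [v]) fun c =>
      linZLeaf H (linAlo a) (linBhi b) ex (linZEncl 0 c) c

/-- The LIN checker over all seven constants (table height `H`; FAMILIES-v1: `H = 12`): all seven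
first-index classes.  For `H ≤ 8` one `decide +kernel` evaluates it; at `H = 12` (12 265 coefficient vectors)
state the four PARTS `linExcludedPart H p a b ex = true` (`p = 0, 1, 2, 3`; ≤ 4 080 vectors each) as separate
one-line theorems and assemble with `linExcluded_of_parts` — a single kernel evaluation of the whole table
does not go through (measured; `H = 8`, 5 488 vectors, does). -/
def linExcluded (H : ℕ) (a b : ℚ) (ex : List (ℤ × List ℤ × ℕ)) : Bool :=
  (List.range 7).all fun i => linExcludedFirst H i a b ex

/-- Part `p` of `linExcluded`: first index `0` (`p = 0`), `1` (`p = 1`), `2, 3` (`p = 2`), `4, 5, 6` (else). -/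
def linExcludedPart (H p : ℕ) (a b : ℚ) (ex : List (ℤ × List ℤ × ℕ)) : Bool :=
  match p with
  | 0 => linExcludedFirst H 0 a b ex
  | 1 => linExcludedFirst H 1 a b ex
  | 2 => linExcludedFirst H 2 a b ex && linExcludedFirst H 3 a b ex
  | _ => linExcludedFirst H 4 a b ex && (linExcludedFirst H 5 a b ex && linExcludedFirst H 6 a b ex)

/-- Assemble `linExcluded` from its four parts (each hypothesis = a separately stated theorem). -/
theorem linExcluded_of_parts {H : ℕ} {a b : ℚ} {ex : List (ℤ × List ℤ × ℕ)}
    (h0 : linExcludedPart H 0 a b ex = true) (h1 : linExcludedPart H 1 a b ex = true)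
    (h2 : linExcludedPart H 2 a b ex = true) (h3 : linExcludedPart H 3 a b ex = true) :
    linExcluded H a b ex = true := by
  simp only [linExcludedPart, Bool.and_eq_true] at h0 h1 h2 h3
  unfold linExcluded
  simp only [List.all_eq_true, List.mem_range]
  intro i hi
  interval_cases i
  · exact h0
  · exact h1
  · exact h2.1
  · exact h2.2
  · exact h3.1
  · exact h3.2.1
  · exact h3.2.2

/-- The first non-zero entry of an integer list that is not identically zero. -/
theorem exists_first_ne_zero : ∀ (c : List ℤ), c ≠ List.replicate c.length 0 →
    ∃ (i : ℕ) (v : ℤ) (rest : List ℤ), c = List.replicate i 0 ++ v :: rest ∧ v ≠ 0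
  | [], h => by simp at h
  | x :: cs, h => by
      by_cases hx : x = 0
      · subst hx
        have h' : cs ≠ List.replicate cs.length 0 := by
          intro e; apply h
          simp only [List.length_cons, List.replicate_succ]
          exact congrArg _ e
        obtain ⟨i, v, rest, hc, hv⟩ := exists_first_ne_zero cs h'
        exact ⟨i + 1, v, rest, by simp [hc, List.replicate_succ], hv⟩
      · exact ⟨0, x, cs, by simp, hx⟩

/-- Leading zeros do not count. -/
theorem filter_ne_zero_replicate_append (i : ℕ) (l : List ℤ) :
    (List.replicate i (0 : ℤ) ++ l).filter (· ≠ 0) = l.filter (· ≠ 0) := by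
  induction i with
  | zero => simp
  | succ n _ => simp [List.replicate_succ]

/-- **Soundness of the LIN sentence.** If `linExcluded H a b ex = true` then every member of
`linFamily H` in `[a, b]` equals the value of a listed tuple. -/
theorem linExcluded_sound {H : ℕ} {a b : ℚ} {ex : List (ℤ × List ℤ × ℕ)}
    (hc : linExcluded H a b ex = true) {x : ℝ} (hx : (a : ℝ) ≤ x ∧ x ≤ b)
    (hmem : x ∈ linFamily H) : ∃ e ∈ ex, x = lin7TupleVal e := by
  obtain ⟨a₀, c, ax, hlen, hax1, haxH, hcb, hnz, hc0, rfl⟩ := hmem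
  obtain ⟨hT1, hT2⟩ := linZEncl_sound 0 c
  set T := linZEncl 0 c with hT
  have hax0 : (0 : ℝ) < ax := by exact_mod_cast hax1
  have hS0 : (0 : ℤ) < (linS : ℤ) := by norm_num [linS]
  -- locate the first non-zero coefficient: `c = 0…0 v rest`
  have hc0' : c ≠ List.replicate c.length 0 := by rw [hlen]; exact hc0
  obtain ⟨i, v, rest, hsplit, hv⟩ := exists_first_ne_zero c hc0'
  have hlen' := congrArg List.length hsplit
  simp only [List.length_append, List.length_replicate, List.length_cons] at hlen'
  have hi : i < 7 := by omega
  have hrest : rest.length = 6 - i := by omega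
  have hvb : -(H : ℤ) ≤ v ∧ v ≤ H := hcb v (by rw [hsplit]; simp)
  have hrestb : ∀ y ∈ rest, -(H : ℤ) ≤ y ∧ y ≤ H := fun y hy => hcb y (by rw [hsplit]; simp [hy])
  have hrestnz : (rest.filter (· ≠ 0)).length ≤ 1 := by
    have e : c.filter (· ≠ 0) = v :: rest.filter (· ≠ 0) := by
      rw [hsplit, filter_ne_zero_replicate_append, List.filter_cons_of_pos (by simpa using hv)]
    rw [e, List.length_cons] at hnz
    omega
  -- the class of first index `i`, at the value `v`
  unfold linExcluded at hc
  have h1 := List.all_eq_true.mp hc i (List.mem_range.mpr hi)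
  unfold linExcludedFirst at h1
  have h1' := allIntIcc_sound h1 hvb.1 hvb.2
  simp only [Bool.or_eq_true, decide_eq_true_eq] at h1'
  rcases h1' with h1' | h1'
  · exact absurd h1' hv
  have h4 := loopNZ_sound (6 - i) 1 _ h1' rest hrest hrestb hrestnz
  have hc' : List.replicate i 0 ++ [v] ++ rest = c := by rw [hsplit]; simp
  rw [hc'] at h4
  -- the integer leaf
  simp only [linZLeaf] at h4
  have h2 := List.all_eq_true.mp h4 ax (List.mem_range'_1.mpr ⟨hax1, by omega⟩)
  have hlo' : (a : ℝ) * ax ≤ a₀ + lin7Val 0 c := by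
    have := mul_le_mul_of_nonneg_right hx.1 hax0.le; rwa [div_mul_cancel₀ _ hax0.ne'] at this
  have hhi' : (a₀ : ℝ) + lin7Val 0 c ≤ b * ax := by
    have := mul_le_mul_of_nonneg_right hx.2 hax0.le; rwa [div_mul_cancel₀ _ hax0.ne'] at this
  have hA : ((linAlo a : ℤ) : ℝ) ≤ (linS : ℝ) * a := by
    have h := Int.floor_le ((linS : ℚ) * a)
    have h' : ((⌊(linS : ℚ) * a⌋ : ℚ) : ℝ) ≤ (((linS : ℚ) * a : ℚ) : ℝ) := Rat.cast_le.mpr h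
    push_cast at h'
    simpa [linAlo] using h'
  have hB : (linS : ℝ) * b ≤ ((linBhi b : ℤ) : ℝ) := by
    have h := Int.le_ceil ((linS : ℚ) * b)
    have h' : (((linS : ℚ) * b : ℚ) : ℝ) ≤ ((⌈(linS : ℚ) * b⌉ : ℚ) : ℝ) := Rat.cast_le.mpr h
    push_cast at h'
    simpa [linBhi] using h'
  have hSR : (0 : ℝ) ≤ (linS : ℝ) := by positivity
  have i1 : linAlo a * ax - T.2 ≤ a₀ * linS := by
    have e1 : ((linAlo a : ℤ) : ℝ) * ax ≤ linS * a * ax := mul_le_mul_of_nonneg_right hA hax0.le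
    have e2 : (linS : ℝ) * a * ax ≤ linS * (a₀ + lin7Val 0 c) := by
      rw [mul_assoc]; exact mul_le_mul_of_nonneg_left hlo' hSR
    have e3 : ((linAlo a : ℤ) : ℝ) * ax - T.2 ≤ a₀ * linS := by nlinarith
    exact_mod_cast e3
  have i2 : a₀ * linS ≤ linBhi b * ax - T.1 := by
    have e1 : (linS : ℝ) * b * ax ≤ ((linBhi b : ℤ) : ℝ) * ax := mul_le_mul_of_nonneg_right hB hax0.le
    have e2 : (linS : ℝ) * (a₀ + lin7Val 0 c) ≤ linS * b * ax := by
      rw [mul_assoc]; exact mul_le_mul_of_nonneg_left hhi' hSR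
    have e3 : (a₀ : ℝ) * linS ≤ ((linBhi b : ℤ) : ℝ) * ax - T.1 := by nlinarith
    exact_mod_cast e3
  have hlo : -((-(linAlo a * ax - T.2)) / (linS : ℤ)) ≤ a₀ := by
    have h := (Int.le_ediv_iff_mul_le hS0).mpr
      (show -a₀ * (linS : ℤ) ≤ -(linAlo a * ax - T.2) by linarith)
    linarith
  have hhi : a₀ ≤ (linBhi b * ax - T.1) / (linS : ℤ) := (Int.le_ediv_iff_mul_le hS0).mpr i2
  have h3 := allIntIcc_sound h2 hlo hhi
  unfold linZCandOK at h3
  simp only [List.any_eq_true, decide_eq_true_eq] at h3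
  obtain ⟨e, he, he0, hea, hec⟩ := h3
  refine ⟨e, he, ?_⟩
  unfold lin7TupleVal
  have he0' : (0 : ℝ) < e.2.2 := by exact_mod_cast he0
  rw [div_eq_div_iff hax0.ne' he0'.ne']
  have hv := lin7Val_mul_eq 0 c e.2.1 hec
  push_cast at hv
  have hea' : (a₀ : ℝ) * e.2.2 = e.1 * ax := by exact_mod_cast hea
  calc ((a₀ : ℝ) + lin7Val 0 c) * e.2.2 = (a₀ : ℝ) * e.2.2 + lin7Val 0 c * e.2.2 := by ring
    _ = (e.1 : ℝ) * ax + lin7Val 0 e.2.1 * ax := by rw [hea', hv]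
    _ = ((e.1 : ℝ) + lin7Val 0 e.2.1) * ax := by ring

/-! ### Bridges from the floor's statements -/

/-- **LIN sentence for `Δ_σ`.** -/
theorem sigma_lin_covered_of_isingEnclosure {W R : Set (ℝ × ℝ)} (h : IsingEnclosure W R) {a b : ℚ}
    (hR : ∀ q ∈ R, (a : ℝ) ≤ q.1 ∧ q.1 ≤ b) {H : ℕ} {ex : List (ℤ × List ℤ × ℕ)}
    (hx : linExcluded H a b ex = true) (D : SigmaEpsilonData) (hD : D.SatisfiesBootstrapAxioms)
    (hW : (D.Δσ, D.Δε) ∈ W) (hmem : D.Δσ ∈ linFamily H) : ∃ e ∈ ex, D.Δσ = lin7TupleVal e :=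
  linExcluded_sound hx (hR _ (h D hD hW)) hmem

/-- **LIN sentence for `Δ_ε`.** -/
theorem eps_lin_covered_of_isingEnclosure {W R : Set (ℝ × ℝ)} (h : IsingEnclosure W R) {a b : ℚ}
    (hR : ∀ q ∈ R, (a : ℝ) ≤ q.2 ∧ q.2 ≤ b) {H : ℕ} {ex : List (ℤ × List ℤ × ℕ)}
    (hx : linExcluded H a b ex = true) (D : SigmaEpsilonData) (hD : D.SatisfiesBootstrapAxioms)
    (hW : (D.Δσ, D.Δε) ∈ W) (hmem : D.Δε ∈ linFamily H) : ∃ e ∈ ex, D.Δε = lin7TupleVal e :=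
  linExcluded_sound hx (hR _ (h D hD hW)) hmem

end Summit.CriticalPhenomena.Ising3D
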